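import Summits.QuantumFields.YangMills.Theorems.UnitScaleTiltProp7OneFormPointwiseDecayKnit
import Summits.QuantumFields.YangMills.Theorems.UnitScaleTiltProp7OneFormLocalRemainderDecay
import Summits.QuantumFields.YangMills.Theorems.UnitScaleTiltProp7OneFormRemainderDecay
import HarnessLib

/-!
# Route `UnitScaleTilt`, crux K1 «MinimiserStabilityRegPr» (stmt-QuantumFields-19200), EX face S46 — (L3′b), ONE-FORM STOREY, FILE O4-E2E:
# **THE POINTWISE EXPONENTIAL DECAY OF `Δ_a(U₀)⁻¹` AT THE SLOT OF RECORD, END TO END — displayed ONLY by A4's block decay and the two kernel rows `hk_D`, `hk_Q`**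
# (O4-KNIT ∘ px16 g13's ✓`hqdom_of_letters` ∘ O4e ✓`norm_symm_apply_le_of_kernelRow_blockDecay`; the X-slot term vanishes at `DeltaEtaSlot`)

Cell `ym3-torus` (HUMAN RULING D-0037; rung R3 = SU(2) YM₃ on T³ — NOT d = 4, NOT infinite volume, NOT a mass gap, NOT Clay).  Chair seat ★`ym-ust-19200-p1` g26, own pen O4-E2E.
THEOREMS ONLY (0 `def`, 0 `sorry`, default heartbeats); `--supports stmt-QuantumFields-19200 --as helper`; count-neutral.

WHAT IS PROVED (ns `Summit.QuantumFields.YangMills.Theorems.Prop7OneFormPointwiseDecayE2E`).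
* `equiv_eq_frobEquiv_symm` — currency bridge `WL2.equiv g p = frobEquiv⁻¹((toL2⁻¹ g)((bondEquiv)⁻¹ p))`; ★ `norm_equiv_apply_le_of_kernelRow_blockDecay` — O4e in the `WL2.equiv` currency (`√2`).
* ★★★ `pointwiseDecay_oneForm_DeltaEtaSlot` — on `RegPr F n K ε₀ U₀`, for `Δ_a u = f` at the slot `DeltaEtaSlot` (ANY coupling `a`), a source supported on the bonds of one block `v`
  with `|f| ≤ F`, the block decay `‖1_y u‖ ≤ D₀e^{−r·tdist(y,v)}` (A4's shape), the kernel rows `hk_D` (for `D(1−R_S)D*`, = the EX row `h349`'s member text) and `hk_Q` (for `Q_k†(a•Q_k)`)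
  at a rate `μ′ > r`, and `(32√2ε₀e^{5r})·(8e^{3r})·14 < 1`:  `∃ κ₁ ∈ (0, r]`, `‖u(p₀)‖ ≤ A·e^{−κ₁·tdist(B(p₀), v)}` at EVERY bond, with the explicit K-free-at-the-pins constant `A`.
HONEST SCOPE.  Assembly; CONDITIONAL on A4's block decay letter (itself fed by (γ) coercivity — OPEN —, (C_V), (θ_V)) and the two displayed kernel rows; nothing of the ten EX rows, `hT`,
(3.42) for print's operators, EX or the crux is proved here.

References: T. Bałaban, CMP **99** (1985) 389–434 [Balaban1985BackgroundPropagators] (Thm 3.1 (3.42) p.397, (3.46) p.398, (3.49) p.399, Thm 3.12 p.422); CMP **95** (1984) 17–40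
[Balaban1984PropagatorsI] (Prop. 1.1 p.33).
-/

set_option autoImplicit false

noncomputable section

open scoped Matrix.Norms.L2Operator BigOperators InnerProductSpace ComplexConjugate

namespace Summit.QuantumFields.YangMills.Theorems.Prop7OneFormPointwiseDecayE2E

open Literature.MathematicalPhysics.QuantumFieldTheory.Balaban1983to89
open Literature.MathematicalPhysics.QuantumFieldTheory.Balaban1983to89.T3ContinuumYM3Torus
open Literature.MathematicalPhysics.QuantumFieldTheory.Balaban1983to89.T3PrintedRegularMinimiser (RegPr)
open T3SectALandauChart (formComp bgUnits eta eta_pos)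
open B4Sect5Torus (TSite)
open B9SectCLatticeCarrier (Bond)
open B9Eq311L2Pairing (WL2)
open B9TorusCalculus (torusT)
open B9Eq310Hermitian (deltaPrimeOp)
open B11Eq135Weitzenbock (curvOp)
open B11Eq103H1Complex (BondL2K)
open B5Eq118OneStroke (iterBlockOf)
open Summit.QuantumFields.YangMills.Theorems.Prop7SectET3Transport (periodsT3 siteEquiv bondEquiv)
open Summit.QuantumFields.YangMills.Theorems.Prop7SectET3HilbertLetters (W₂ frobEquiv toL2 toL2_symm_apply DL2 DstarL2)
open Summit.QuantumFields.YangMills.Theorems.Prop7SectET3WilsonHessian (DeltaEta DeltaEtaSlot)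
open Summit.QuantumFields.YangMills.Theorems.Prop7SectET3GaugeProjector (RS)
open Summit.QuantumFields.YangMills.Theorems.Prop7SectET3CurvedPropagators (laplaceA Qk)
open Summit.QuantumFields.YangMills.Theorems.Prop7RieszTauFrobNorm (norm_frobEquiv_symm_le)
open Summit.QuantumFields.YangMills.Theorems.Prop7OneFormPointwiseDecayKnit (pointwiseDecay_oneForm_knit)
open Summit.QuantumFields.YangMills.Theorems.Prop7OneFormLocalRemainderDecay (hqdom_of_letters blockDist_le_blockDist_add_five)
open Summit.QuantumFields.YangMills.Theorems.Prop7OneFormRemainderDecay (norm_symm_apply_le_of_kernelRow_blockDecay)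

variable {F : T3Family} {n K : ℕ} {c₀ : ℝ} [Fact (0 < c₀)]

/-! ## §1 The currency bridge and O4e in the `WL2.equiv` currency -/

omit [Fact (0 < c₀)] in
/-- `WL2.equiv g p = frobEquiv⁻¹((toL2⁻¹ g)((bondEquiv)⁻¹ p))` (✓`toL2_symm_apply` read backwards). [cite: Balaban1985BackgroundPropagators, (3.11) p.392] -/
theorem equiv_eq_frobEquiv_symm (g : BondL2K ℂ 3 (periodsT3 F K) c₀ W₂) (p : Bond 3 (periodsT3 F K)) :
    WL2.equiv ℂ _ W₂ g p = frobEquiv.symm ((toL2 F K c₀).symm g ((bondEquiv F K).symm p)) := by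
  rw [toL2_symm_apply, Equiv.apply_symm_apply, LinearEquiv.symm_apply_apply]

/-- ★ **O4e IN THE `WL2.equiv` CURRENCY**: kernel row × block decay ⟹ `‖WL2.equiv (B u) p‖ ≤ √2·C_k·√(d(L^d)^{K−n}∕c₀)·D₀·(2(1+1∕(μ′−r)))³·e^{−r·tdist(B(p), v)}`.
[cite: Balaban1985BackgroundPropagators, (3.46) p.398, (3.49) p.399] -/
theorem norm_equiv_apply_le_of_kernelRow_blockDecay (B : BondL2K ℂ 3 (periodsT3 F K) c₀ W₂ →ₗ[ℂ] BondL2K ℂ 3 (periodsT3 F K) c₀ W₂)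
    {Ck μ' : ℝ} (hCk : 0 ≤ Ck)
    (hk : ∀ (b : PBond (F.P K) 0) (Z : Matrix (Fin 2) (Fin 2) ℂ) (bd : PBond (F.P K) 0),
      ‖(toL2 F K c₀).symm (B (toL2 F K c₀ (Pi.single b Z))) bd‖
        ≤ Ck * Real.exp (-(μ' * (Site.tdist (P := F.P K) (iterBlockOf (K - n) b.src) (iterBlockOf (K - n) bd.src) : ℝ))) * ‖Z‖)
    (u : BondL2K ℂ 3 (periodsT3 F K) c₀ W₂) (v : Site (F.P K) (K - n)) {D₀ r : ℝ} (hD₀ : 0 ≤ D₀) (hr : 0 ≤ r) (hrμ : r < μ')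
    (hD : ∀ y : Site (F.P K) (K - n),
      ‖toL2 F K c₀ (fun b => if iterBlockOf (K - n) b.src = y then (toL2 F K c₀).symm u b else 0)‖ ≤ D₀ * Real.exp (-(r * (Site.tdist y v : ℝ))))
    (p : Bond 3 (periodsT3 F K)) :
    ‖WL2.equiv ℂ _ W₂ (B u) p‖
      ≤ Real.sqrt 2 * (Ck * Real.sqrt (((F.P K).d : ℝ) * ((((F.P K).L : ℝ) ^ (F.P K).d) ^ (K - n)) / c₀) * D₀ * (2 * (1 + 1 / (μ' - r))) ^ 3)
          * Real.exp (-(r * (Site.tdist (iterBlockOf (K - n) ((bondEquiv F K).symm p).src) v : ℝ))) := by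
  have h := norm_symm_apply_le_of_kernelRow_blockDecay F (n := n) B hCk hk ((toL2 F K c₀).symm u) v hD₀ hr hrμ hD ((bondEquiv F K).symm p)
  rw [LinearEquiv.apply_symm_apply] at h
  rw [equiv_eq_frobEquiv_symm]
  calc ‖(frobEquiv.symm ((toL2 F K c₀).symm (B u) ((bondEquiv F K).symm p)) : W₂)‖
      ≤ Real.sqrt 2 * ‖(toL2 F K c₀).symm (B u) ((bondEquiv F K).symm p)‖ := norm_frobEquiv_symm_le _
    _ ≤ _ := by rw [mul_assoc]; exact mul_le_mul_of_nonneg_left h (Real.sqrt_nonneg _)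

/-! ## §2 The pointwise decay at the slot of record, end to end -/

variable {h : n ≤ K} {cB a : ℝ} [Fact (0 < cB)]

set_option maxHeartbeats 400000 in
/-- ★★★ **THE POINTWISE EXPONENTIAL DECAY OF THE ONE-FORM GREEN's FUNCTION AT THE SLOT OF RECORD, END TO END.**  On `RegPr F n K ε₀ U₀`, `Δ_a u = f` at `Δx := DeltaEtaSlot` (ANY coupling),
`f` supported on the bonds of the block `v` with `|f| ≤ F`, `u` with the `L²` block decay `‖1_y u‖ ≤ D₀e^{−r·tdist(y,v)}` (`r > 0`), the kernel rows `hk_D` (`D(1−R_S)D*`) and `hk_Q`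
(`Q_k†(a•Q_k)`) at rate `μ′ > r`, and `(32√2ε₀e^{5r})·(8e^{3r})·14 < 1`.  THEN `∃ κ₁ ∈ (0, r]`, `∀ p₀`, `‖u(p₀)‖ ≤ A·e^{−κ₁·tdist(B(p₀), v)}` with
`A = ((F + √2(C_Q + C_D)√(dℓ^d∕c₀)D₀(2(1+1∕(μ′−r)))³)·(8e^{3r})·14 + √(3³·8∕(c₀ℓ³))·√(8e^{3r}(2(1+1∕r))³)·D₀) ∕ (1 − (32√2ε₀e^{5r})·(8e^{3r})·14)`.
(KNIT ✓`pointwiseDecay_oneForm_knit`; its `hqdom` by px16 ✓`hqdom_of_letters` at every rate `κ₁ ≤ r` with `θ_i = 0`, `t₃ = 0` at the slot, `s_Q`, `s_D` from §1, `e^{5κ₁} ≤ e^{5r}`, `e^{−rd} ≤ e^{−κ₁d}`.)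
HEARTBEATS (disclosed): decl-local budget as for the KNIT it calls (px16 g13 measured the KNIT between 100k and 130k); the mathematics is unaffected.
[cite: Balaban1985BackgroundPropagators, Thm 3.1 (3.42) p.397, (3.46) p.398, (3.49) p.399, Thm 3.12 p.422] -/
theorem pointwiseDecay_oneForm_DeltaEtaSlot (hnK : n ≤ K) {ε₀ : ℝ} (hε₀ : 0 ≤ ε₀) (U₀ : GaugeField (F.P K) 0 (Matrix.specialUnitaryGroup (Fin 2) ℂ)) (hreg : RegPr F n K ε₀ U₀)
    {u f : BondL2K ℂ 3 (periodsT3 F K) c₀ W₂} (hu : laplaceA F n K h c₀ cB a (DeltaEtaSlot F n K c₀) U₀ u = f)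
    (v : Site (F.P K) (K - n)) {Fsrc : ℝ} (hfb : ∀ p, ‖WL2.equiv ℂ _ W₂ f p‖ ≤ Fsrc)
    (hfs : ∀ p, WL2.equiv ℂ _ W₂ f p ≠ 0 → iterBlockOf (K - n) ((bondEquiv F K).symm p).src = v)
    {r D₀ : ℝ} (hr : 0 < r) (hD₀ : 0 ≤ D₀)
    (hD : ∀ y : Site (F.P K) (K - n),
      ‖toL2 F K c₀ (fun b => if iterBlockOf (K - n) b.src = y then (toL2 F K c₀).symm u b else 0)‖ ≤ D₀ * Real.exp (-(r * (Site.tdist y v : ℝ))))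
    {CkD CkQ μ' : ℝ} (hCkD : 0 ≤ CkD) (hCkQ : 0 ≤ CkQ) (hrμ : r < μ')
    (hkD : ∀ (b : PBond (F.P K) 0) (Z : Matrix (Fin 2) (Fin 2) ℂ) (bd : PBond (F.P K) 0),
      ‖(toL2 F K c₀).symm (DL2 F n K c₀ U₀ (DstarL2 F n K c₀ U₀ (toL2 F K c₀ (Pi.single b Z)) - RS F n K h c₀ cB U₀ (DstarL2 F n K c₀ U₀ (toL2 F K c₀ (Pi.single b Z))))) bd‖
        ≤ CkD * Real.exp (-(μ' * (Site.tdist (P := F.P K) (iterBlockOf (K - n) b.src) (iterBlockOf (K - n) bd.src) : ℝ))) * ‖Z‖)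
    (hkQ : ∀ (b : PBond (F.P K) 0) (Z : Matrix (Fin 2) (Fin 2) ℂ) (bd : PBond (F.P K) 0),
      ‖(toL2 F K c₀).symm (LinearMap.adjoint (Qk F n K h c₀ cB U₀) (((a : ℝ) : ℂ) • Qk F n K h c₀ cB U₀ (toL2 F K c₀ (Pi.single b Z)))) bd‖
        ≤ CkQ * Real.exp (-(μ' * (Site.tdist (P := F.P K) (iterBlockOf (K - n) b.src) (iterBlockOf (K - n) bd.src) : ℝ))) * ‖Z‖)
    (hsmall : (32 * Real.sqrt 2 * ε₀ * Real.exp (5 * r)) * (8 * Real.exp (3 * r)) * 14 < 1) :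
    ∃ κ₁ : ℝ, 0 < κ₁ ∧ κ₁ ≤ r ∧ ∀ p₀ : Bond 3 (periodsT3 F K),
      ‖WL2.equiv ℂ _ W₂ u p₀‖
        ≤ (((Fsrc + Real.sqrt 2 * ((CkQ + CkD) * Real.sqrt (((F.P K).d : ℝ) * ((((F.P K).L : ℝ) ^ (F.P K).d) ^ (K - n)) / c₀) * D₀ * (2 * (1 + 1 / (μ' - r))) ^ 3))
                * (8 * Real.exp (3 * r)) * 14
              + Real.sqrt (3 ^ 3 * 8 / (c₀ * ((F.L : ℝ) ^ (K - n)) ^ 3)) * (Real.sqrt (8 * Real.exp (3 * r) * (2 * (1 + 1 / r)) ^ 3) * D₀))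
            / (1 - (32 * Real.sqrt 2 * ε₀ * Real.exp (5 * r)) * (8 * Real.exp (3 * r)) * 14))
          * Real.exp (-(κ₁ * (Site.tdist (iterBlockOf (K - n) ((bondEquiv F K).symm p₀).src) v : ℝ))) := by
  -- the two non-local remainder pieces as linear maps with their rows
  set BD : BondL2K ℂ 3 (periodsT3 F K) c₀ W₂ →ₗ[ℂ] BondL2K ℂ 3 (periodsT3 F K) c₀ W₂ :=
    DL2 F n K c₀ U₀ ∘ₗ (LinearMap.id - RS F n K h c₀ cB U₀) ∘ₗ DstarL2 F n K c₀ U₀ with hBD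
  have hBDv : ∀ w, BD w = DL2 F n K c₀ U₀ (DstarL2 F n K c₀ U₀ w - RS F n K h c₀ cB U₀ (DstarL2 F n K c₀ U₀ w)) := fun w => by
    simp only [hBD, LinearMap.comp_apply, LinearMap.sub_apply, LinearMap.id_apply]
  set BQ : BondL2K ℂ 3 (periodsT3 F K) c₀ W₂ →ₗ[ℂ] BondL2K ℂ 3 (periodsT3 F K) c₀ W₂ :=
    LinearMap.adjoint (Qk F n K h c₀ cB U₀) ∘ₗ (((a : ℝ) : ℂ) • Qk F n K h c₀ cB U₀) with hBQ
  have hBQv : ∀ w, BQ w = LinearMap.adjoint (Qk F n K h c₀ cB U₀) (((a : ℝ) : ℂ) • Qk F n K h c₀ cB U₀ w) := fun w => by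
    simp only [hBQ, LinearMap.comp_apply, LinearMap.smul_apply]
  have hkD' : ∀ (b : PBond (F.P K) 0) (Z : Matrix (Fin 2) (Fin 2) ℂ) (bd : PBond (F.P K) 0), ‖(toL2 F K c₀).symm (BD (toL2 F K c₀ (Pi.single b Z))) bd‖
      ≤ CkD * Real.exp (-(μ' * (Site.tdist (P := F.P K) (iterBlockOf (K - n) b.src) (iterBlockOf (K - n) bd.src) : ℝ))) * ‖Z‖ := fun b Z bd => by
    rw [hBDv]; exact hkD b Z bd
  have hkQ' : ∀ (b : PBond (F.P K) 0) (Z : Matrix (Fin 2) (Fin 2) ℂ) (bd : PBond (F.P K) 0), ‖(toL2 F K c₀).symm (BQ (toL2 F K c₀ (Pi.single b Z))) bd‖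
      ≤ CkQ * Real.exp (-(μ' * (Site.tdist (P := F.P K) (iterBlockOf (K - n) b.src) (iterBlockOf (K - n) bd.src) : ℝ))) * ‖Z‖ := fun b Z bd => by
    rw [hBQv]; exact hkQ b Z bd
  set d : Bond 3 (periodsT3 F K) → ℝ := fun p => (Site.tdist (iterBlockOf (K - n) ((bondEquiv F K).symm p).src) v : ℝ) with hd
  set N : ℝ := Real.sqrt (((F.P K).d : ℝ) * ((((F.P K).L : ℝ) ^ (F.P K).d) ^ (K - n)) / c₀) with hN
  set Vr : ℝ := (2 * (1 + 1 / (μ' - r))) ^ 3 with hVr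
  have hμr : 0 < μ' - r := by linarith
  have hVr0 : 0 ≤ Vr := by rw [hVr]; positivity
  -- the decayed bounds of the (Q) and (D) pieces at rate `r`
  have hQ : ∀ p, ‖WL2.equiv ℂ _ W₂ (BQ u) p‖ ≤ Real.sqrt 2 * (CkQ * N * D₀ * Vr) * Real.exp (-(r * d p)) :=
    norm_equiv_apply_le_of_kernelRow_blockDecay (n := n) BQ hCkQ hkQ' u v hD₀ hr.le hrμ hD
  have hDp : ∀ p, ‖WL2.equiv ℂ _ W₂ (BD u) p‖ ≤ Real.sqrt 2 * (CkD * N * D₀ * Vr) * Real.exp (-(r * d p)) :=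
    norm_equiv_apply_le_of_kernelRow_blockDecay (n := n) BD hCkD hkD' u v hD₀ hr.le hrμ hD
  -- the X-slot term vanishes at the slot of record
  have hX0 : ∀ p, WL2.equiv ℂ _ W₂ ((DeltaEtaSlot F n K c₀ U₀
      - (DeltaEta F n K c₀ U₀ : BondL2K ℂ 3 (periodsT3 F K) c₀ W₂ →ₗ[ℂ] BondL2K ℂ 3 (periodsT3 F K) c₀ W₂)) u) p = 0 := fun p => by
    have : (DeltaEtaSlot F n K c₀ U₀ - (DeltaEta F n K c₀ U₀ : BondL2K ℂ 3 (periodsT3 F K) c₀ W₂ →ₗ[ℂ] BondL2K ℂ 3 (periodsT3 F K) c₀ W₂)) = 0 := sub_self _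
    rw [this, LinearMap.zero_apply, WL2.equiv_zero]; rfl
  -- the `hqdom` letter of the KNIT, uniformly in the rate `κ₁ ≤ r`
  set sD : ℝ := Real.sqrt 2 * ((CkQ + CkD) * N * D₀ * Vr) with hsD
  set θ : ℝ := 32 * Real.sqrt 2 * ε₀ * Real.exp (5 * r) with hθ
  refine pointwiseDecay_oneForm_knit (h := h) (cB := cB) (a := a) (Δx := DeltaEtaSlot F n K c₀) hnK U₀ hu (q := fun p =>
      WL2.equiv ℂ _ W₂ (LinearMap.adjoint (Qk F n K h c₀ cB U₀) (((a : ℝ) : ℂ) • Qk F n K h c₀ cB U₀ u)) p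
      - WL2.equiv ℂ _ W₂ (DL2 F n K c₀ U₀ (DstarL2 F n K c₀ U₀ u - RS F n K h c₀ cB U₀ (DstarL2 F n K c₀ U₀ u))) p
      + WL2.equiv ℂ _ W₂ ((DeltaEtaSlot F n K c₀ U₀ - (DeltaEta F n K c₀ U₀ : BondL2K ℂ 3 (periodsT3 F K) c₀ W₂ →ₗ[ℂ] BondL2K ℂ 3 (periodsT3 F K) c₀ W₂)) u) p
      + frobEquiv.symm ((eta F n K)⁻¹ • (eta F n K)⁻¹ •
          (deltaPrimeOp (torusT (F.P K) 0) (fun ν x => bgUnits F K U₀ ⟨x, ν⟩) 1 (formComp ((toL2 F K c₀).symm u)) p.2 ((siteEquiv F K).symm p.1)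
            - curvOp (torusT (F.P K) 0) (fun ν x => bgUnits F K U₀ ⟨x, ν⟩) (formComp ((toL2 F K c₀).symm u)) p.2 ((siteEquiv F K).symm p.1))))
    (fun _ => rfl) v hfb hfs hr hD₀ hD (sD := sD) (θ := θ) (by positivity) (by positivity) ?_ hsmall
  intro κ₁ hκ₁0 hκ₁r p
  haveI : Nonempty (Bond 3 (periodsT3 F K)) := ⟨p⟩
  -- px16's knit at rate `κ₁` with `t₃ = 0`, `θ_i = 0`
  have hS0 : 0 ≤ ⨆ p', ‖WL2.equiv ℂ _ W₂ u p'‖ * Real.exp (κ₁ * d p') :=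
    le_trans (by positivity) (le_ciSup (f := fun p' => ‖WL2.equiv ℂ _ W₂ u p'‖ * Real.exp (κ₁ * d p')) (Set.finite_range _).bddAbove p)
  have hmono : ∀ p', Real.exp (-(r * d p')) ≤ Real.exp (-(κ₁ * d p')) := fun p' => by
    have : 0 ≤ d p' := Nat.cast_nonneg _
    exact Real.exp_le_exp.mpr (by nlinarith)
  have h₁ : ∀ p', ‖WL2.equiv ℂ _ W₂ (LinearMap.adjoint (Qk F n K h c₀ cB U₀) (((a : ℝ) : ℂ) • Qk F n K h c₀ cB U₀ u)) p'‖
      ≤ (Real.sqrt 2 * (CkQ * N * D₀ * Vr) + 0 * ⨆ p'', ‖WL2.equiv ℂ _ W₂ u p''‖ * Real.exp (κ₁ * d p'')) * Real.exp (-(κ₁ * d p')) := fun p' => by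
    rw [zero_mul, add_zero, ← hBQv]
    exact (hQ p').trans (mul_le_mul_of_nonneg_left (hmono p') (by positivity))
  have h₂ : ∀ p', ‖WL2.equiv ℂ _ W₂ (DL2 F n K c₀ U₀ (DstarL2 F n K c₀ U₀ u - RS F n K h c₀ cB U₀ (DstarL2 F n K c₀ U₀ u))) p'‖
      ≤ (Real.sqrt 2 * (CkD * N * D₀ * Vr) + 0 * ⨆ p'', ‖WL2.equiv ℂ _ W₂ u p''‖ * Real.exp (κ₁ * d p'')) * Real.exp (-(κ₁ * d p')) := fun p' => by
    rw [zero_mul, add_zero, ← hBDv]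
    exact (hDp p').trans (mul_le_mul_of_nonneg_left (hmono p') (by positivity))
  have h₃ : ∀ p', ‖WL2.equiv ℂ _ W₂ ((DeltaEtaSlot F n K c₀ U₀
      - (DeltaEta F n K c₀ U₀ : BondL2K ℂ 3 (periodsT3 F K) c₀ W₂ →ₗ[ℂ] BondL2K ℂ 3 (periodsT3 F K) c₀ W₂)) u) p'‖
      ≤ (0 + 0 * ⨆ p'', ‖WL2.equiv ℂ _ W₂ u p''‖ * Real.exp (κ₁ * d p'')) * Real.exp (-(κ₁ * d p')) := fun p' => by
    rw [hX0, norm_zero]; simp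
  have hk := hqdom_of_letters U₀ hreg u _ _ _ _ (fun p' => rfl) d (κ := κ₁) (r := 5) hκ₁0 (blockDist_le_blockDist_add_five v) h₁ h₂ h₃ p
  refine hk.trans (mul_le_mul_of_nonneg_right ?_ (Real.exp_pos _).le)
  have hθκ : 32 * Real.sqrt 2 * ε₀ * Real.exp (κ₁ * 5) ≤ θ := by
    rw [hθ]; exact mul_le_mul_of_nonneg_left (Real.exp_le_exp.mpr (by linarith)) (by positivity)
  have hs : Real.sqrt 2 * (CkQ * N * D₀ * Vr) + Real.sqrt 2 * (CkD * N * D₀ * Vr) + 0 = sD := by rw [hsD]; ring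
  rw [hs, zero_add, zero_add, zero_add]
  exact add_le_add le_rfl (mul_le_mul_of_nonneg_right hθκ hS0)

end Summit.QuantumFields.YangMills.Theorems.Prop7OneFormPointwiseDecayE2E

end
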